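import Summits.AnomalousDissipation.AnomalousDissipation.Theorems.SawtoothPulseCascadeK1LocalisedCascadeColumnBound

/-!
# K1loc, line `Spectral` — S-D: THE ANALYTIC FIRST GOOD PIECE WITH SYMBOLIC SMALLNESS (hstart of the ledger)

Helper file of the prover lane on the crux `K1LocalisedCascade` (stmt-AnomalousDissipation-19491), route
`SawtoothPulseCascade`, registered line `Cruxes.K1LocalisedCascade.Spectral` (one open stub `stub_highModeConcentration`).
The analytic T4 of memo v8 §5/§8 (route (i)) as ONE lemma with the smallness of `δ₀` SYMBOLIC: its hypotheses are the R1 inequalities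
(`E_V ≥ Err_ℓ`, `E_H ≥ (1+γ)E_V + γη((1+γ+γ²)^n + E_V)`, `M₂δ_j + 2πN_j E ≤ M₁δ_j`, `M₁δ_j + 2πN_j E ≤ M₃δ_j`, `M₃δ_j < π/2`, the potential
budget `B₀ ≥ (γ²−3)^{−n}`, `B_{ℓ+1} ≥ 4B_ℓ + 2N_j(γ+2+2/γ)/(γ²−3)^{n−ℓ}`) and its conclusion is the hypothesis `hstart` of
`…K1Ledger.highModeConcentration_of_ledger_threshold` (through `…StartAssembly.sqrt_tsum_symbol_sq_datum_le_of_lineMean`) with the explicit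
numbers `Γ = C₀² + (2C₀ + 1)·V_B` (column; `C₀ = B_n/π + 2πE_V`, `V_B = Σ_{j<n} 4M₃δ_j/π`) and `Λ = #R · (C_K + V_B)²` (rest set `R` of
low modes off the column with `|k₀| ≤ K₀ < (γ²−3)^n`; `C_K = B_n/(π(1 − K₀(γ²−3)^{−n})) + 2πE_V`).

* `axisAvg_indicator_props` — the section function `axisAvg 0 1_{Bad}`: measurable, in `[0, 1]`, `∫ = vol(Bad)`;
* `B_pos` — the potential budget is positive;
* `sqrt_lowModes_le_firstGoodPiece` — the statement above.

WHAT THIS IS NOT: no choice of the numbers (`M₁, M₂, M₃, E_V, E_H, B, K₀`, hence `δ₀`); that is the R1 decision (memo v8 §5, kit/t4_budget.py).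
[cite: ElgindiLissMattingly2025, §1.2.2, §3.1] [cite: DEIJ2022, (1.2)–(1.3)] [problem: turb]
-/

-- `Summit.<Summit>.<Problem>`: single-conjunct summit, the duplicate namespace segment is deliberate.
set_option linter.dupNamespace false

noncomputable section

namespace Summit.AnomalousDissipation.AnomalousDissipation.Theorems.SawtoothPulseCascade.K1Start

open Set Function MeasureTheory UnitAddTorus
open scoped ENNReal
open Literature.Analysis Literature.Analysis.FunctionSpaces Literature.Analysis.FunctionSpaces.Torus
open Literature.Analysis.FluidPDE.ShearStage
open Literature.Analysis.FluidPDE.SawtoothCascade Literature.Analysis.FluidPDE.SawtoothCascade.CascadeParams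

/-! ## §1 The section function of a measurable set -/

/-- The section function `h = axisAvg 0 1_{Bad}` of a measurable `Bad ⊆ 𝕋²` is a.e. strongly measurable, takes values in `[0, 1]`, and
`∫ h = vol(Bad)` (Fubini along `e₀`). [folklore] -/
theorem axisAvg_indicator_props {Bad : Set (UnitAddTorus (Fin 2))} (hBadm : MeasurableSet Bad) :
    AEStronglyMeasurable (axisAvg 0 (Bad.indicator fun _ => (1 : ℝ))) volume ∧
    (∀ x, 0 ≤ axisAvg 0 (Bad.indicator fun _ => (1 : ℝ)) x ∧ axisAvg 0 (Bad.indicator fun _ => (1 : ℝ)) x ≤ 1) ∧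
    ∫ x, axisAvg 0 (Bad.indicator fun _ => (1 : ℝ)) x = (volume Bad).toReal := by
  have hind_i : Integrable (Bad.indicator fun _ => (1 : ℝ)) (volume : Measure (UnitAddTorus (Fin 2))) :=
    (integrable_const (1 : ℝ)).indicator hBadm
  refine ⟨aestronglyMeasurable_axisAvg hind_i.aestronglyMeasurable, fun x => ⟨?_, ?_⟩, ?_⟩
  · rw [axisAvg_apply]
    exact integral_nonneg fun s => Set.indicator_nonneg (fun _ _ => zero_le_one) _
  · rw [axisAvg_apply]
    have h1 : ‖∫ s : UnitAddCircle, Bad.indicator (fun _ => (1 : ℝ)) (x + Pi.single 0 s)‖ ≤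
        1 * (volume : Measure UnitAddCircle).real univ := by
      refine norm_integral_le_of_norm_le_const (Filter.Eventually.of_forall fun s => ?_)
      rw [Real.norm_eq_abs, abs_le]
      by_cases hs : x + Pi.single 0 s ∈ Bad <;> simp [Set.indicator, hs]
    rw [one_mul, probReal_univ, Real.norm_eq_abs] at h1
    exact (le_abs_self _).trans h1
  · rw [← integral_eq_integral_axisAvg 0 hind_i, MeasureTheory.integral_indicator hBadm, setIntegral_const, smul_eq_mul, mul_one,
      measureReal_def]

/-! ## §2 The assembly -/

section Cascade

variable (P : CascadeParams)

/-- The potential budget is positive: `B_ℓ > 0` for `ℓ ≤ n`. [folklore] -/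
theorem B_pos (hγ : 1 ≤ P.γ) (h8 : 8 ≤ P.γ ^ 2) {n : ℕ} (B : ℕ → ℝ) (hB0 : ((P.γ ^ 2 - 3) ^ n)⁻¹ ≤ B 0)
    (hB : ∀ ℓ, ℓ < n → 4 * B ℓ + 2 * P.N (n - ℓ - 1) * (P.γ + 2 + 2 / P.γ) / (P.γ ^ 2 - 3) ^ (n - ℓ) ≤ B (ℓ + 1)) :
    ∀ ℓ, ℓ ≤ n → 0 < B ℓ := by
  have hg3 : 0 < P.γ ^ 2 - 3 := by nlinarith
  have hγ0 : 0 < P.γ := by linarith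
  intro ℓ
  induction ℓ with
  | zero => exact fun _ => lt_of_lt_of_le (inv_pos.mpr (pow_pos hg3 n)) hB0
  | succ ℓ ih =>
    intro hℓ
    have h1 := ih (by omega)
    have h2 := hB ℓ (by omega)
    have h3 : 0 ≤ 2 * (P.N (n - ℓ - 1) : ℝ) * (P.γ + 2 + 2 / P.γ) / (P.γ ^ 2 - 3) ^ (n - ℓ) :=
      div_nonneg (by positivity) (pow_nonneg hg3.le _)
    linarith

/-- **The analytic first good piece with symbolic smallness** (memo v8 §5/§8, route (i)): under the R1 inequalities (see the file
header) the hypothesis `hstart` of the ledger holds at `i₀ = n` with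
`Γ = (B_n/π + 2πE_V)² + (2(B_n/π + 2πE_V) + 1)·Σ_{j<n} 4M₃δ_j/π` and
`Λ = #R·(B_n/(π(1 − K₀/(γ²−3)^n)) + 2πE_V + Σ_{j<n} 4M₃δ_j/π)²`:
for every `κ ∈ (0, κ₁]` and every classical cascade scalar `w` from the datum,
`√(Σ' μ(k)²|𝓕(w(tStart n))(k)|²) ≤ √(Γ + Λ) + √(2π√(1+(1+γ)²)(1+γ)^{2n}√(2κ₁ tStart n ‖datum‖²))`.
[cite: ElgindiLissMattingly2025, §1.2.2, §3.1] [cite: DEIJ2022, (1.2)–(1.3)] -/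
theorem sqrt_lowModes_le_firstGoodPiece (hγ : 1 ≤ P.γ) (h8 : 8 ≤ P.γ ^ 2) (hδ₀ : 0 < P.δ₀) (hd : 0 < P.d) (hN₀ : 1 ≤ P.N₀) (hρ : 1 ≤ P.ρN)
    {M₁ M₂ M₃ : ℝ} (hM₁ : 0 < M₁) (hM : 1 ≤ M₂) (hMδ : ∀ j, M₂ * P.δ j < Real.pi / 2) (hM₃ : 1 ≤ M₃)
    (hM₃δ : ∀ j, M₃ * P.δ j < Real.pi / 2) {n : ℕ}
    (a b : ℕ → UnitAddTorus (Fin 2) → ℝ) (has : ∀ j, IsSmooth (a j)) (h0 : a 0 = datum)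
    (hb : ∀ j, b j = a j ∘ shearMap 0 1 (amp ⟨P.U j, P.U_periodic j, P.contDiff_U (P.δ_pos hδ₀ hd j)⟩ P.γ))
    (hab : ∀ j, a (j + 1) = b j ∘ shearMap 1 0 (amp ⟨P.U j, P.U_periodic j, P.contDiff_U (P.δ_pos hδ₀ hd j)⟩ P.γ))
    {EV EH : ℝ} (B : ℕ → ℝ) (hEV0 : 0 ≤ EV)
    (hEV : ∀ ℓ, ℓ ≤ n → (∑ i ∈ Finset.range ℓ, (1 + P.γ + P.γ ^ 2) ^ i *
        ((P.γ ^ 2 * (1 / (2 * P.N (n - ℓ + i)) - M₂ * P.δ (n - ℓ + i) / (Real.pi * P.N (n - ℓ + i))) +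
          P.γ * (1 / (2 * P.N (n - ℓ + i)) - M₂ * P.δ (n - ℓ + i) / (Real.pi * P.N (n - ℓ + i)))) *
          (2 * Real.exp (-(M₂ ^ 2 / 2))))) ≤ EV)
    (hEH : (1 + P.γ) * EV + P.γ * (2 * Real.exp (-(M₂ ^ 2 / 2))) * ((1 + P.γ + P.γ ^ 2) ^ n + EV) ≤ EH)
    (hζV : ∀ j, M₂ * P.δ j / (2 * Real.pi * P.N j) + EV ≤ M₁ * P.δ j / (2 * Real.pi * P.N j))
    (hζH : ∀ j, M₂ * P.δ j / (2 * Real.pi * P.N j) + EH ≤ M₁ * P.δ j / (2 * Real.pi * P.N j))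
    (hV3 : ∀ j, M₁ * P.δ j / (2 * Real.pi * P.N j) + EV ≤ M₃ * P.δ j / (2 * Real.pi * P.N j))
    (hH3 : ∀ j, M₁ * P.δ j / (2 * Real.pi * P.N j) + EH ≤ M₃ * P.δ j / (2 * Real.pi * P.N j))
    (hB0 : ((P.γ ^ 2 - 3) ^ n)⁻¹ ≤ B 0)
    (hB : ∀ ℓ, ℓ < n → 4 * B ℓ + 2 * P.N (n - ℓ - 1) * (P.γ + 2 + 2 / P.γ) / (P.γ ^ 2 - 3) ^ (n - ℓ) ≤ B (ℓ + 1))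
    (μ : (Fin 2 → ℤ) → ℝ) (hμ1 : ∀ k, |μ k| ≤ 1) (R : Finset (Fin 2 → ℤ)) (hμ : ∀ k, k 0 ≠ 0 → k ∉ R → μ k = 0)
    {K₀ : ℝ} (hK₀ : K₀ < (P.γ ^ 2 - 3) ^ n) (hR : ∀ k ∈ R, |((k 0 : ℤ) : ℝ)| ≤ K₀) {κ₁ : ℝ} :
    ∀ κ ∈ Ioc (0 : ℝ) κ₁, ∀ w : ℝ → UnitAddTorus (Fin 2) → ℝ,
      FluidPDE.Torus.IsClassicalScalarTransportOn (Ico 0 1) κ P.field w → w 0 = datum →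
        Real.sqrt (∑' k, μ k ^ 2 * ‖mFourierCoeff (fun x => (w (tStart n) x : ℂ)) k‖ ^ 2) ≤
          Real.sqrt (((B n / Real.pi + 2 * Real.pi * EV) ^ 2 +
              (2 * (B n / Real.pi + 2 * Real.pi * EV) + 1) * ∑ j ∈ Finset.range n, 4 * M₃ * P.δ j / Real.pi) +
            R.card * (B n / (Real.pi * (1 - K₀ / (P.γ ^ 2 - 3) ^ n)) + 2 * Real.pi * EV +
              ∑ j ∈ Finset.range n, 4 * M₃ * P.δ j / Real.pi) ^ 2) +
          Real.sqrt (2 * Real.pi * Real.sqrt (1 + (1 + P.γ) ^ 2) * (1 + P.γ) ^ (2 * n) *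
            Real.sqrt (2 * κ₁ * tStart n * FluidPDE.Torus.scalarL2Sq datum)) := by
  classical
  have hπ := Real.pi_pos
  have hγ0 : 0 < P.γ := by linarith
  have hg3 : 0 < P.γ ^ 2 - 3 := by nlinarith
  have hBn : 0 < B n := B_pos P hγ h8 B hB0 hB n le_rfl
  -- the bad set and its volume
  obtain ⟨Bad, hBadm, hBadvol, hBad⟩ := exists_badSet P hδ₀ hd hN₀ hρ (EV := EV) (EH := EH) hM₃ hM₃δ hV3 hH3 n
  set VB : ℝ := ∑ j ∈ Finset.range n, 4 * M₃ * P.δ j / Real.pi with hVB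
  have hVBge : (volume Bad).toReal ≤ VB := by
    have hterm : ∀ j, 0 ≤ 4 * M₃ * P.δ j / Real.pi := fun j => by
      have := P.δ_pos hδ₀ hd j
      positivity
    have h1 : volume Bad ≤ ENNReal.ofReal VB := by
      refine hBadvol.trans (le_of_eq ?_)
      rw [hVB, ENNReal.ofReal_sum_of_nonneg fun j _ => hterm j]
      refine Finset.sum_congr rfl fun j _ => ?_
      rw [← ENNReal.ofReal_ofNat 2, ← ENNReal.ofReal_mul (by norm_num)]
      congr 1
      ring
    exact ENNReal.toReal_le_of_le_ofReal (Finset.sum_nonneg fun j _ => hterm j) h1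
  obtain ⟨hh_meas, hh01, hh_int⟩ := axisAvg_indicator_props hBadm
  set h : UnitAddTorus (Fin 2) → ℝ := axisAvg 0 (Bad.indicator fun _ => (1 : ℝ)) with hh
  set C₀ : ℝ := B n / Real.pi + 2 * Real.pi * EV with hC₀
  have hC₀0 : 0 ≤ C₀ := by positivity
  -- the column majorant `g = C₀ + h`
  have hle : ∀ x, |axisAvg 0 (a n) x| ≤ C₀ + h x := fun x =>
    abs_axisAvg_iterate_le P hγ h8 hδ₀ hd hN₀ hρ hM₁ hM hMδ a b h0 hb hab B hEV0 hEV hEH hζV hζH hB0 hB Bad hBadm hBad x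
  have hh_i : Integrable h volume :=
    Integrable.of_bound hh_meas 1 (Filter.Eventually.of_forall fun x => by
      rw [Real.norm_eq_abs, abs_le]; exact ⟨by linarith [(hh01 x).1], (hh01 x).2⟩)
  have hg_i : Integrable (fun x => (C₀ + h x) ^ 2) volume := by
    refine Integrable.of_bound ((aestronglyMeasurable_const.add hh_meas).pow 2) ((C₀ + 1) ^ 2)
      (Filter.Eventually.of_forall fun x => ?_)
    rw [Real.norm_eq_abs, abs_of_nonneg (sq_nonneg _)]
    exact pow_le_pow_left₀ (by linarith [(hh01 x).1]) (by linarith [(hh01 x).2]) 2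
  have hΓ : ∫ x, (C₀ + h x) ^ 2 ≤ C₀ ^ 2 + (2 * C₀ + 1) * VB := by
    have hpt : ∀ x, (C₀ + h x) ^ 2 ≤ C₀ ^ 2 + (2 * C₀ + 1) * h x := by
      intro x
      have h1 : h x ^ 2 ≤ h x := by nlinarith [(hh01 x).1, (hh01 x).2]
      nlinarith
    calc ∫ x, (C₀ + h x) ^ 2 ≤ ∫ x, (C₀ ^ 2 + (2 * C₀ + 1) * h x) :=
          integral_mono hg_i ((integrable_const _).add (hh_i.const_mul _)) hpt
      _ = C₀ ^ 2 + (2 * C₀ + 1) * (volume Bad).toReal := by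
          rw [integral_add (integrable_const _) (hh_i.const_mul _), MeasureTheory.integral_const, integral_const_mul, hh_int,
            probReal_univ, one_smul]
      _ ≤ C₀ ^ 2 + (2 * C₀ + 1) * VB := by gcongr
  -- the rest set
  set CK : ℝ := B n / (Real.pi * (1 - K₀ / (P.γ ^ 2 - 3) ^ n)) + 2 * Real.pi * EV with hCK
  have hθ : 0 < 1 - K₀ / (P.γ ^ 2 - 3) ^ n := by
    rw [sub_pos, div_lt_one (pow_pos hg3 n)]; exact hK₀
  have hcoef : ∀ k ∈ R, ‖mFourierCoeff (fun x => (a n x : ℂ)) k‖ ≤ CK + VB := by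
    intro k hk
    have hk0 : |((k 0 : ℤ) : ℝ)| < (P.γ ^ 2 - 3) ^ n := (hR k hk).trans_lt hK₀
    have h1 := norm_mFourierCoeff_iterate_le P hγ h8 hδ₀ hd hN₀ hρ hM₁ hM hMδ a b h0 hb hab B hEV0 hEV hEH hζV hζH hB0 hB
      Bad hBadm hBad has k hk0
    have hθk : 0 < 1 - |((k 0 : ℤ) : ℝ)| / (P.γ ^ 2 - 3) ^ n := by
      rw [sub_pos, div_lt_one (pow_pos hg3 n)]; exact hk0
    have h2 : B n / (Real.pi * (1 - |((k 0 : ℤ) : ℝ)| / (P.γ ^ 2 - 3) ^ n)) ≤ B n / (Real.pi * (1 - K₀ / (P.γ ^ 2 - 3) ^ n)) := by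
      refine div_le_div_of_nonneg_left hBn.le (by positivity) (mul_le_mul_of_nonneg_left ?_ hπ.le)
      have := div_le_div_of_nonneg_right (hR k hk) (pow_pos hg3 n).le
      linarith
    linarith
  have hΛ : ∑' k : Fin 2 → ℤ, (if k ∈ (R : Set (Fin 2 → ℤ)) then (1 : ℝ) else 0) *
      ‖mFourierCoeff (fun x => (a n x : ℂ)) k‖ ^ 2 ≤ R.card * (CK + VB) ^ 2 := by
    have hsum : ∑' k : Fin 2 → ℤ, (if k ∈ (R : Set (Fin 2 → ℤ)) then (1 : ℝ) else 0) *
        ‖mFourierCoeff (fun x => (a n x : ℂ)) k‖ ^ 2 = ∑ k ∈ R, ‖mFourierCoeff (fun x => (a n x : ℂ)) k‖ ^ 2 := by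
      rw [tsum_eq_sum (s := R) (fun k hk => by simp [hk])]
      exact Finset.sum_congr rfl fun k hk => by simp [hk]
    rw [hsum]
    calc ∑ k ∈ R, ‖mFourierCoeff (fun x => (a n x : ℂ)) k‖ ^ 2 ≤ ∑ k ∈ R, (CK + VB) ^ 2 :=
          Finset.sum_le_sum fun k hk => pow_le_pow_left₀ (norm_nonneg _) (hcoef k hk) 2
      _ = R.card * (CK + VB) ^ 2 := by rw [Finset.sum_const, nsmul_eq_mul]
  -- assemble
  have hres := sqrt_tsum_symbol_sq_datum_le_of_lineMean P hγ0.le hδ₀ hd a b has h0 hb hab n μ hμ1 (R : Set (Fin 2 → ℤ))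
    (fun k hk0 hkR => hμ k hk0 (by exact_mod_cast hkR)) hg_i hle hΓ hΛ (κ₁ := κ₁)
  simpa only [hC₀, hCK, hVB] using hres

end Cascade

end Summit.AnomalousDissipation.AnomalousDissipation.Theorems.SawtoothPulseCascade.K1Start
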